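import Summits.Ventures.FusionMHD.Bench.SAlphaU067Stages
import HarnessLib

/-!
# F3 — `s–α` at `(s, α) = (1, 67/100)`: even-solution enclosure transcript, KERNEL CHECK FILE 1/4 (stages 0–14: HOE step test ∧ landing,
# one `decide` per stage)
(venture LADDER-GRIDFUSION, rung F3 — the validated-ODE TWIN of the unstable point `(s, α) = (1, 67/100)` of ★ #192 (TT witness):
instability from a kernel-certified SIGN CHANGE of the even solution through lit-3's conjugate-point socket
`Ballooning.SAlpha.exists_unstableWitnessPW3_of_signChange`; cell `gridfusion`, typed by gridfusion-lit-3 (g13), 2026-08-28; generator =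
lit-3's untrusted Lean-interpreter search `scratch/GenSAlphaChain60u.lean`; 0 `def … : Prop` facts, 0 kit jobs, no `native_decide`, no floating
point.  The per-stage facts are stated through `chain.certAt j` / `chain.initAt (j + 1)` (the transcript's own accessors).)
-/

open NonemptyInterval
open Literature.Analysis.ODE Literature.Analysis.ValidatedNumerics Literature.Analysis.ValidatedNumerics.ITaylor

namespace Summit.Ventures.FusionMHD.Bench.SAlphaU067

/-- Stage 0 of the transcript: the elementary HOE step test AND the landing of its end box in the hand-over box of stage 1 — ONE kernel
evaluation. [cite: Moore1979, §8.1 eq. (8.10) with (8.13)] [cite: NedialkovJacksonCorliss1999, §5 Algorithm I] -/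
theorem uok00 : ((chain.certAt 0).check && boxLE (chain.certAt 0).endBox (chain.initAt 1)) = true := by
  decide +kernel

/-- Stage 0 passes the step test. [cite: Moore1979, §8.1 eq. (8.10) with (8.13)] -/
theorem uok00c : (chain.certAt 0).check = true := (Bool.and_eq_true_iff.1 uok00).1

/-- The end box of stage 0 lands in the hand-over box of stage 1. [cite: NedialkovJacksonCorliss1999, §5 Algorithm I] -/
theorem uok00b : boxLE (chain.certAt 0).endBox (chain.initAt 1) = true := (Bool.and_eq_true_iff.1 uok00).2

/-- Stage 1 of the transcript: the elementary HOE step test AND the landing of its end box in the hand-over box of stage 2 — ONE kernel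
evaluation. [cite: Moore1979, §8.1 eq. (8.10) with (8.13)] [cite: NedialkovJacksonCorliss1999, §5 Algorithm I] -/
theorem uok01 : ((chain.certAt 1).check && boxLE (chain.certAt 1).endBox (chain.initAt 2)) = true := by
  decide +kernel

/-- Stage 1 passes the step test. [cite: Moore1979, §8.1 eq. (8.10) with (8.13)] -/
theorem uok01c : (chain.certAt 1).check = true := (Bool.and_eq_true_iff.1 uok01).1

/-- The end box of stage 1 lands in the hand-over box of stage 2. [cite: NedialkovJacksonCorliss1999, §5 Algorithm I] -/
theorem uok01b : boxLE (chain.certAt 1).endBox (chain.initAt 2) = true := (Bool.and_eq_true_iff.1 uok01).2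

/-- Stage 2 of the transcript: the elementary HOE step test AND the landing of its end box in the hand-over box of stage 3 — ONE kernel
evaluation. [cite: Moore1979, §8.1 eq. (8.10) with (8.13)] [cite: NedialkovJacksonCorliss1999, §5 Algorithm I] -/
theorem uok02 : ((chain.certAt 2).check && boxLE (chain.certAt 2).endBox (chain.initAt 3)) = true := by
  decide +kernel

/-- Stage 2 passes the step test. [cite: Moore1979, §8.1 eq. (8.10) with (8.13)] -/
theorem uok02c : (chain.certAt 2).check = true := (Bool.and_eq_true_iff.1 uok02).1

/-- The end box of stage 2 lands in the hand-over box of stage 3. [cite: NedialkovJacksonCorliss1999, §5 Algorithm I] -/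
theorem uok02b : boxLE (chain.certAt 2).endBox (chain.initAt 3) = true := (Bool.and_eq_true_iff.1 uok02).2

/-- Stage 3 of the transcript: the elementary HOE step test AND the landing of its end box in the hand-over box of stage 4 — ONE kernel
evaluation. [cite: Moore1979, §8.1 eq. (8.10) with (8.13)] [cite: NedialkovJacksonCorliss1999, §5 Algorithm I] -/
theorem uok03 : ((chain.certAt 3).check && boxLE (chain.certAt 3).endBox (chain.initAt 4)) = true := by
  decide +kernel

/-- Stage 3 passes the step test. [cite: Moore1979, §8.1 eq. (8.10) with (8.13)] -/
theorem uok03c : (chain.certAt 3).check = true := (Bool.and_eq_true_iff.1 uok03).1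

/-- The end box of stage 3 lands in the hand-over box of stage 4. [cite: NedialkovJacksonCorliss1999, §5 Algorithm I] -/
theorem uok03b : boxLE (chain.certAt 3).endBox (chain.initAt 4) = true := (Bool.and_eq_true_iff.1 uok03).2

/-- Stage 4 of the transcript: the elementary HOE step test AND the landing of its end box in the hand-over box of stage 5 — ONE kernel
evaluation. [cite: Moore1979, §8.1 eq. (8.10) with (8.13)] [cite: NedialkovJacksonCorliss1999, §5 Algorithm I] -/
theorem uok04 : ((chain.certAt 4).check && boxLE (chain.certAt 4).endBox (chain.initAt 5)) = true := by
  decide +kernel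

/-- Stage 4 passes the step test. [cite: Moore1979, §8.1 eq. (8.10) with (8.13)] -/
theorem uok04c : (chain.certAt 4).check = true := (Bool.and_eq_true_iff.1 uok04).1

/-- The end box of stage 4 lands in the hand-over box of stage 5. [cite: NedialkovJacksonCorliss1999, §5 Algorithm I] -/
theorem uok04b : boxLE (chain.certAt 4).endBox (chain.initAt 5) = true := (Bool.and_eq_true_iff.1 uok04).2

/-- Stage 5 of the transcript: the elementary HOE step test AND the landing of its end box in the hand-over box of stage 6 — ONE kernel
evaluation. [cite: Moore1979, §8.1 eq. (8.10) with (8.13)] [cite: NedialkovJacksonCorliss1999, §5 Algorithm I] -/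
theorem uok05 : ((chain.certAt 5).check && boxLE (chain.certAt 5).endBox (chain.initAt 6)) = true := by
  decide +kernel

/-- Stage 5 passes the step test. [cite: Moore1979, §8.1 eq. (8.10) with (8.13)] -/
theorem uok05c : (chain.certAt 5).check = true := (Bool.and_eq_true_iff.1 uok05).1

/-- The end box of stage 5 lands in the hand-over box of stage 6. [cite: NedialkovJacksonCorliss1999, §5 Algorithm I] -/
theorem uok05b : boxLE (chain.certAt 5).endBox (chain.initAt 6) = true := (Bool.and_eq_true_iff.1 uok05).2

/-- Stage 6 of the transcript: the elementary HOE step test AND the landing of its end box in the hand-over box of stage 7 — ONE kernel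
evaluation. [cite: Moore1979, §8.1 eq. (8.10) with (8.13)] [cite: NedialkovJacksonCorliss1999, §5 Algorithm I] -/
theorem uok06 : ((chain.certAt 6).check && boxLE (chain.certAt 6).endBox (chain.initAt 7)) = true := by
  decide +kernel

/-- Stage 6 passes the step test. [cite: Moore1979, §8.1 eq. (8.10) with (8.13)] -/
theorem uok06c : (chain.certAt 6).check = true := (Bool.and_eq_true_iff.1 uok06).1

/-- The end box of stage 6 lands in the hand-over box of stage 7. [cite: NedialkovJacksonCorliss1999, §5 Algorithm I] -/
theorem uok06b : boxLE (chain.certAt 6).endBox (chain.initAt 7) = true := (Bool.and_eq_true_iff.1 uok06).2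

/-- Stage 7 of the transcript: the elementary HOE step test AND the landing of its end box in the hand-over box of stage 8 — ONE kernel
evaluation. [cite: Moore1979, §8.1 eq. (8.10) with (8.13)] [cite: NedialkovJacksonCorliss1999, §5 Algorithm I] -/
theorem uok07 : ((chain.certAt 7).check && boxLE (chain.certAt 7).endBox (chain.initAt 8)) = true := by
  decide +kernel

/-- Stage 7 passes the step test. [cite: Moore1979, §8.1 eq. (8.10) with (8.13)] -/
theorem uok07c : (chain.certAt 7).check = true := (Bool.and_eq_true_iff.1 uok07).1

/-- The end box of stage 7 lands in the hand-over box of stage 8. [cite: NedialkovJacksonCorliss1999, §5 Algorithm I] -/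
theorem uok07b : boxLE (chain.certAt 7).endBox (chain.initAt 8) = true := (Bool.and_eq_true_iff.1 uok07).2

/-- Stage 8 of the transcript: the elementary HOE step test AND the landing of its end box in the hand-over box of stage 9 — ONE kernel
evaluation. [cite: Moore1979, §8.1 eq. (8.10) with (8.13)] [cite: NedialkovJacksonCorliss1999, §5 Algorithm I] -/
theorem uok08 : ((chain.certAt 8).check && boxLE (chain.certAt 8).endBox (chain.initAt 9)) = true := by
  decide +kernel

/-- Stage 8 passes the step test. [cite: Moore1979, §8.1 eq. (8.10) with (8.13)] -/
theorem uok08c : (chain.certAt 8).check = true := (Bool.and_eq_true_iff.1 uok08).1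

/-- The end box of stage 8 lands in the hand-over box of stage 9. [cite: NedialkovJacksonCorliss1999, §5 Algorithm I] -/
theorem uok08b : boxLE (chain.certAt 8).endBox (chain.initAt 9) = true := (Bool.and_eq_true_iff.1 uok08).2

/-- Stage 9 of the transcript: the elementary HOE step test AND the landing of its end box in the hand-over box of stage 10 — ONE kernel
evaluation. [cite: Moore1979, §8.1 eq. (8.10) with (8.13)] [cite: NedialkovJacksonCorliss1999, §5 Algorithm I] -/
theorem uok09 : ((chain.certAt 9).check && boxLE (chain.certAt 9).endBox (chain.initAt 10)) = true := by
  decide +kernel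

/-- Stage 9 passes the step test. [cite: Moore1979, §8.1 eq. (8.10) with (8.13)] -/
theorem uok09c : (chain.certAt 9).check = true := (Bool.and_eq_true_iff.1 uok09).1

/-- The end box of stage 9 lands in the hand-over box of stage 10. [cite: NedialkovJacksonCorliss1999, §5 Algorithm I] -/
theorem uok09b : boxLE (chain.certAt 9).endBox (chain.initAt 10) = true := (Bool.and_eq_true_iff.1 uok09).2

/-- Stage 10 of the transcript: the elementary HOE step test AND the landing of its end box in the hand-over box of stage 11 — ONE kernel
evaluation. [cite: Moore1979, §8.1 eq. (8.10) with (8.13)] [cite: NedialkovJacksonCorliss1999, §5 Algorithm I] -/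
theorem uok10 : ((chain.certAt 10).check && boxLE (chain.certAt 10).endBox (chain.initAt 11)) = true := by
  decide +kernel

/-- Stage 10 passes the step test. [cite: Moore1979, §8.1 eq. (8.10) with (8.13)] -/
theorem uok10c : (chain.certAt 10).check = true := (Bool.and_eq_true_iff.1 uok10).1

/-- The end box of stage 10 lands in the hand-over box of stage 11. [cite: NedialkovJacksonCorliss1999, §5 Algorithm I] -/
theorem uok10b : boxLE (chain.certAt 10).endBox (chain.initAt 11) = true := (Bool.and_eq_true_iff.1 uok10).2

/-- Stage 11 of the transcript: the elementary HOE step test AND the landing of its end box in the hand-over box of stage 12 — ONE kernel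
evaluation. [cite: Moore1979, §8.1 eq. (8.10) with (8.13)] [cite: NedialkovJacksonCorliss1999, §5 Algorithm I] -/
theorem uok11 : ((chain.certAt 11).check && boxLE (chain.certAt 11).endBox (chain.initAt 12)) = true := by
  decide +kernel

/-- Stage 11 passes the step test. [cite: Moore1979, §8.1 eq. (8.10) with (8.13)] -/
theorem uok11c : (chain.certAt 11).check = true := (Bool.and_eq_true_iff.1 uok11).1

/-- The end box of stage 11 lands in the hand-over box of stage 12. [cite: NedialkovJacksonCorliss1999, §5 Algorithm I] -/
theorem uok11b : boxLE (chain.certAt 11).endBox (chain.initAt 12) = true := (Bool.and_eq_true_iff.1 uok11).2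

/-- Stage 12 of the transcript: the elementary HOE step test AND the landing of its end box in the hand-over box of stage 13 — ONE kernel
evaluation. [cite: Moore1979, §8.1 eq. (8.10) with (8.13)] [cite: NedialkovJacksonCorliss1999, §5 Algorithm I] -/
theorem uok12 : ((chain.certAt 12).check && boxLE (chain.certAt 12).endBox (chain.initAt 13)) = true := by
  decide +kernel

/-- Stage 12 passes the step test. [cite: Moore1979, §8.1 eq. (8.10) with (8.13)] -/
theorem uok12c : (chain.certAt 12).check = true := (Bool.and_eq_true_iff.1 uok12).1

/-- The end box of stage 12 lands in the hand-over box of stage 13. [cite: NedialkovJacksonCorliss1999, §5 Algorithm I] -/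
theorem uok12b : boxLE (chain.certAt 12).endBox (chain.initAt 13) = true := (Bool.and_eq_true_iff.1 uok12).2

/-- Stage 13 of the transcript: the elementary HOE step test AND the landing of its end box in the hand-over box of stage 14 — ONE kernel
evaluation. [cite: Moore1979, §8.1 eq. (8.10) with (8.13)] [cite: NedialkovJacksonCorliss1999, §5 Algorithm I] -/
theorem uok13 : ((chain.certAt 13).check && boxLE (chain.certAt 13).endBox (chain.initAt 14)) = true := by
  decide +kernel

/-- Stage 13 passes the step test. [cite: Moore1979, §8.1 eq. (8.10) with (8.13)] -/
theorem uok13c : (chain.certAt 13).check = true := (Bool.and_eq_true_iff.1 uok13).1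

/-- The end box of stage 13 lands in the hand-over box of stage 14. [cite: NedialkovJacksonCorliss1999, §5 Algorithm I] -/
theorem uok13b : boxLE (chain.certAt 13).endBox (chain.initAt 14) = true := (Bool.and_eq_true_iff.1 uok13).2

/-- Stage 14 of the transcript: the elementary HOE step test AND the landing of its end box in the hand-over box of stage 15 — ONE kernel
evaluation. [cite: Moore1979, §8.1 eq. (8.10) with (8.13)] [cite: NedialkovJacksonCorliss1999, §5 Algorithm I] -/
theorem uok14 : ((chain.certAt 14).check && boxLE (chain.certAt 14).endBox (chain.initAt 15)) = true := by
  decide +kernel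

/-- Stage 14 passes the step test. [cite: Moore1979, §8.1 eq. (8.10) with (8.13)] -/
theorem uok14c : (chain.certAt 14).check = true := (Bool.and_eq_true_iff.1 uok14).1

/-- The end box of stage 14 lands in the hand-over box of stage 15. [cite: NedialkovJacksonCorliss1999, §5 Algorithm I] -/
theorem uok14b : boxLE (chain.certAt 14).endBox (chain.initAt 15) = true := (Bool.and_eq_true_iff.1 uok14).2

end Summit.Ventures.FusionMHD.Bench.SAlphaU067
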